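import Summits.CriticalPhenomena.PercolationContinuityZ3.Theorems.PercNearOneGluingNoHeavyQuantGatedConvSplit
import Summits.CriticalPhenomena.PercolationContinuityZ3.Theorems.PercNearOneGluingNoHeavyQuantDECAtTMixtures
import HarnessLib

/-!
# QUANT lane R8, T-DEC: THE GATE-COUPLING MIXTURE — `gate_{q′}(μ ∗ gate_q ν)` is an EXPLICIT two-component mixture, at its own
# target, of `gate_a(μ ∗ ν)` and either `gate_{a₀} μ` or `μ ∗ gate_{b₀} ν`; hence the gate step of the tree induction is FREE for every
# outer gate `q′ ≤ S/(S + qR)` whenever the increment's opened floor does not exceed the environment's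

builds on p205010 (kernel theorem, internal audit signed; external expert review pending)

Support file (`--supports stmt-CriticalPhenomena-4575`), QUANT lane seat prim-quant-arm-1 (gen 45, architect); memo
`run/shared/lean/prim/quant/prim-quant-arm-1-g45/ARCH-LIGHT-G45.md`.  Theorems only (no definitions, no `@[conjecture]`), standard
axioms, no sorries.

THE SETTING (the "environment + gated increment" reading of the structural induction `treeBuilt_sdec`).  A forest law is built by
repeatedly adding to an ENVIRONMENT law `μ` (floor `x`, mean `S`, the forest so far) an INCREMENT `gate_q ν` (a subtree: root gate `q`
over the OPENED subtree law `ν`, floor `y`, mean `R`).  What the induction needs is `SDEC` of `μ ∗ gate_q ν` at floor `min(x, qy)`,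
i.e. for every outer gate `0 < q′ ≤ 1`, `DEC` of `E′ := gate_{q′}(μ ∗ gate_q ν)` at floor `q′·min(x, qy)` and target (its mean)
`T_E = q′(S + qR)`; and the induction may assume `SDEC` of `μ`, of `ν` AND of the opened product `μ ∗ ν` (fewer gates).

THE OBSERVATION (arm-1 g45).  `E′` is the law of `B′(X + B·Y)` (`B′ ~ q′`, `B ~ q`, `X ~ μ`, `Y ~ ν` independent); the joint law of
the two effective gates `(B′, B′B) ∈ {0,1}²` is the point `(p₁₁, p₁₀, p₀₀) = (q′q, q′(1−q), 1−q′)` of the face `p₀₁ = 0`, and the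
mean `T = S·(p₁₁+p₁₀) + R·p₁₁` is LINEAR on that face.  The three edges of the face are laws with certificates in hand:
`gate_a(μ ∗ ν)` (diagonal edge; `SDEC (μ ∗ ν)`), `gate_a μ` (`SDEC μ`), `μ ∗ gate_b ν` (ungated product; `ConvClosedT`).  The level line
of the mean through the point meets the diagonal edge at `a⋆ = q′(S+qR)/(S+R)` and the boundary at `gate_{a₀} μ`, `a₀ = q′(S+qR)/S`
(CASE B: `q′(S+qR) ≤ S`) or at `μ ∗ gate_{b₀} ν`, `b₀ = q′q − (1−q′)S/R` (CASE A).  Hence the IDENTITIES (pure algebra,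
`gateCoupling_mixture_B/_A`):
  (B) `E′ = t·gate_{a⋆}(μ ∗ ν) + (1−t)·gate_{a₀} μ`, `t = q(S+R)/(S+qR)`;
  (A) `E′ = v·gate_{a⋆}(μ ∗ ν) + (1−v)·(μ ∗ gate_{b₀} ν)`, `v = (1−q′)/(1−a⋆)`,
with BOTH components of mean exactly `T_E`, so `decAtT_mixture` applies at the common target `T_E` as soon as the components'
certificates live at floors `≥ z := q′·min(x, qy)`.  In CASE B the floors are `a⋆·min(x,y)` and `a₀·x ≥ q′x ≥ z`; and
`a⋆·min(x,y) ≥ z` holds whenever `y ≤ x` (because `(S+qR)/(S+R) ≥ q`) — more generally whenever `(S+qR)·min(x,y) ≥ (S+R)·min(x,qy)`.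

* `decAt_gateCoupling_B` — **THEOREM (the gate step below the environment's mean share).**  `μ` a top-affordable probability law on
  `{0..M₁}` at floor `x`, `SDEC x`, mean `S > 0`; `ν` a probability law on `{0..M₂}`, mean `R`; the opened product `μ ∗ ν` `SDEC` at a
  floor `w`; `0 < q ≤ 1`; outer gate `0 < q′` with `q′(S + qR) ≤ S`; any floor `z ≤ a⋆·w`, `z ≤ a⋆·x`: then `gate_{q′}(μ ∗ gate_q ν)` is
  `DEC(j)` at floor `z` at EVERY layer `j < M₁ + M₂`.
* `decAt_gateCoupling_B_light` — the tree-induction form: `w = y ≤ x` (increment opened-floor at most the environment floor), conclusion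
  at the TRUE floor `z = q′·q·y` for every outer gate `q′ ≤ S/(S+qR)`.
* `decAt_gateCoupling_A` — CASE A with the second component's certificate as a hypothesis (it is `ConvClosedT` at floor `min(x, b₀y)`;
  the floor test `min(x, b₀ y) ≥ z` is what fails in general — memo §3).

HONEST STATUS.  This closes the gate step only in the regime stated (outer gate at most the environment's mean share `S/(S+qR)`, and
`y ≤ x` or the displayed floor inequality); tied structures (`x = qy`, e.g. two tied blocks) are NOT covered — there the true certificate
re-routes across the two components (memo §3, worked instance).  `SDECConvClosed`, `SGCGiantStep`, `TreeBuiltDEC`, `Quant.FarTreeRow`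
remain OPEN; the RATE class (log\*) and the honest sentence of `run/shared/lean/prim/quant/README.md` are unchanged.  Complements lead
g41's `…QuantGateBelowQuantile` (gate step free at layers below the floor-quantile): here whole LAWS, in a regime of gates.
[this work]; SDEC / the structural induction: prim-quant-census-2 g53; `decAtT_mixture`: prim-quant-stmt g19 (this lane).  Nothing here
is a published result.  The gluing rows served [cite: KozmaNitzan2024, Conjecture 3 (p. 15)]; product measure [cite: Grimmett1999, §1.3 p. 10].
-/

noncomputable section

namespace Summit.CriticalPhenomena.PercolationContinuityZ3.Theorems

namespace Quant

open Finset

namespace LawDec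

/-! ### The gate-coupling mixture identities (pure algebra) -/

/-- convolution with a gated law is the `q`-mixture of the plain convolution and the first factor:
`μ ∗ gate_q ν = q·(μ ∗ ν) + (1−q)·μ` (for `μ` vanishing above its top). [this work] -/
theorem lconv_gate_right (M₁ M₂ : ℕ) (μ ν : ℕ → ℝ) (q : ℝ) (hμM : ∀ h, M₁ < h → μ h = 0) (h : ℕ) :
    lconv M₁ M₂ μ (gate ν q) h = q * lconv M₁ M₂ μ ν h + (1 - q) * μ h := by
  have e : gate ν q = fun k => q * ν k + (1 - q) * (if k = 0 then (1 : ℝ) else 0) := by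
    funext k; rw [gate_apply]
  rw [e, lconv_lin_right, lconv_delta_right M₁ M₂ μ hμM h]

/-- **THE GATE-COUPLING IDENTITY, CASE B** (`S ≠ 0`): with `a⋆ = q′(S+qR)/(S+R)`, `a₀ = q′(S+qR)/S`, `t = q(S+R)/(S+qR)`,
`gate_{q′}(μ ∗ gate_q ν) = t·gate_{a⋆}(μ ∗ ν) + (1−t)·gate_{a₀} μ` pointwise.  (`S`, `R` are free reals here; in use they are the
means.) [this work] -/
theorem gateCoupling_mixture_B (M₁ M₂ : ℕ) (μ ν : ℕ → ℝ) (q q' S R : ℝ) (hμM : ∀ h, M₁ < h → μ h = 0)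
    (hS : S ≠ 0) (hSR : S + R ≠ 0) (hSqR : S + q * R ≠ 0) (h : ℕ) :
    gate (lconv M₁ M₂ μ (gate ν q)) q' h
      = (q * (S + R) / (S + q * R)) * gate (lconv M₁ M₂ μ ν) (q' * (S + q * R) / (S + R)) h
        + (1 - q * (S + R) / (S + q * R)) * gate μ (q' * (S + q * R) / S) h := by
  rw [gate_apply, gate_apply, gate_apply, lconv_gate_right M₁ M₂ μ ν q hμM h]
  field_simp
  ring

/-- **THE GATE-COUPLING IDENTITY, CASE A** (`R ≠ 0`, `a⋆ ≠ 1`): with `a⋆ = q′(S+qR)/(S+R)`, `b₀ = q′q − (1−q′)S/R`,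
`v = (1−q′)/(1−a⋆)`, `gate_{q′}(μ ∗ gate_q ν) = v·gate_{a⋆}(μ ∗ ν) + (1−v)·(μ ∗ gate_{b₀} ν)` pointwise. [this work] -/
theorem gateCoupling_mixture_A (M₁ M₂ : ℕ) (μ ν : ℕ → ℝ) (q q' S R : ℝ) (hμM : ∀ h, M₁ < h → μ h = 0)
    (hR : R ≠ 0) (hSR : S + R ≠ 0) (ha : S + R - q' * (S + q * R) ≠ 0) (h : ℕ) :
    gate (lconv M₁ M₂ μ (gate ν q)) q' h
      = ((1 - q') / (1 - q' * (S + q * R) / (S + R))) * gate (lconv M₁ M₂ μ ν) (q' * (S + q * R) / (S + R)) h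
        + (1 - (1 - q') / (1 - q' * (S + q * R) / (S + R)))
            * lconv M₁ M₂ μ (gate ν (q' * q - (1 - q') * S / R)) h := by
  rw [gate_apply, gate_apply, lconv_gate_right M₁ M₂ μ ν q hμM h,
    lconv_gate_right M₁ M₂ μ ν _ hμM h]
  have h1 : (1 : ℝ) - q' * (S + q * R) / (S + R) = (S + R - q' * (S + q * R)) / (S + R) := by
    field_simp
  rw [h1]
  field_simp
  ring

/-! ### Small law facts -/

/-- a top-affordable probability law with positive mean, gated by `0 < a ≤ 1`, is DEC at every layer at and above its top, at floor
`a·x` (Theorem A). [this work] -/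
theorem decAt_gate_of_top_le (M : ℕ) (μ : ℕ → ℝ) (x a : ℝ) (hx0 : 0 ≤ x) (hax1 : a * x < 1) (ha0 : 0 ≤ a) (ha1 : a ≤ 1)
    (hμ0 : ∀ h, 0 ≤ μ h) (hμM : ∀ h, M < h → μ h = 0) (hμ1 : ∑ h ∈ Finset.range (M + 1), μ h = 1)
    (hta : x * (M : ℝ) ≤ ∑ h ∈ Finset.range (M + 1), (h : ℝ) * μ h) (j : ℕ) (hj : M ≤ j) :
    DECAt (a * x) j M (gate μ a) := by
  obtain ⟨g0, gM, g1⟩ := gate_laws M μ a ha0 ha1 hμ0 hμM hμ1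
  refine decAt_of_top_le M (gate μ a) g0 gM g1 (a * x) hax1 (fun h hh => ?_) j hj
  rw [sum_mul_gate]
  have hhM : h ≤ M := by
    by_contra hlt
    exact absurd (gM h (not_le.1 hlt)) (ne_of_gt hh)
  have h1 : x * (h : ℝ) ≤ x * (M : ℝ) := mul_le_mul_of_nonneg_left (by exact_mod_cast hhM) hx0
  have h2 : a * (x * (h : ℝ)) ≤ a * ∑ h ∈ Finset.range (M + 1), (h : ℝ) * μ h :=
    mul_le_mul_of_nonneg_left (h1.trans hta) ha0
  linarith

/-! ### CASE B: the gate step below the environment's mean share -/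

/-- **THE GATE STEP BELOW THE ENVIRONMENT'S MEAN SHARE (CASE B).**  Environment `μ` (top-affordable probability law on `{0..M₁}`, floor
`0 < x < 1`, `SDEC x`, mean `S > 0`), increment `ν` (probability law on `{0..M₂}`, mean `R`), the opened product `μ ∗ ν` `SDEC` at a floor
`0 ≤ w < 1`, an increment gate `0 < q ≤ 1` and an outer gate `0 < q′` with `q′·(S + q·R) ≤ S`.  Then for every floor `z` with
`z ≤ a⋆·w` and `z ≤ a⋆·x` (`a⋆ = q′(S+qR)/(S+R)`), the doubly gated law `gate_{q′}(μ ∗ gate_q ν)` is DEC(j) at floor `z` at every layer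
`j < M₁ + M₂` — by the Case-B identity it is a mixture, at the common target `q′(S+qR)`, of `gate_{a⋆}(μ ∗ ν)` and `gate_{a₀} μ`. [this work] -/
theorem decAt_gateCoupling_B (x w z q q' : ℝ) (M₁ M₂ : ℕ) (μ ν : ℕ → ℝ)
    (hx0 : 0 < x) (hx1 : x < 1) (hw0 : 0 ≤ w) (hw1 : w < 1) (hq0 : 0 < q) (hq1 : q ≤ 1) (hq'0 : 0 < q')
    (hμ0 : ∀ h, 0 ≤ μ h) (hμM : ∀ h, M₁ < h → μ h = 0) (hμ1 : ∑ h ∈ Finset.range (M₁ + 1), μ h = 1)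
    (hν0 : ∀ h, 0 ≤ ν h) (hνM : ∀ h, M₂ < h → ν h = 0) (hν1 : ∑ h ∈ Finset.range (M₂ + 1), ν h = 1)
    (hS0 : 0 < ∑ h ∈ Finset.range (M₁ + 1), (h : ℝ) * μ h)
    (hta : x * (M₁ : ℝ) ≤ ∑ h ∈ Finset.range (M₁ + 1), (h : ℝ) * μ h)
    (hB : q' * ((∑ h ∈ Finset.range (M₁ + 1), (h : ℝ) * μ h) + q * ∑ h ∈ Finset.range (M₂ + 1), (h : ℝ) * ν h)
      ≤ ∑ h ∈ Finset.range (M₁ + 1), (h : ℝ) * μ h)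
    (hSμ : SDEC x M₁ μ) (hL : SDEC w (M₁ + M₂) (lconv M₁ M₂ μ ν))
    (hzw : z ≤ q' * ((∑ h ∈ Finset.range (M₁ + 1), (h : ℝ) * μ h) + q * ∑ h ∈ Finset.range (M₂ + 1), (h : ℝ) * ν h)
      / ((∑ h ∈ Finset.range (M₁ + 1), (h : ℝ) * μ h) + ∑ h ∈ Finset.range (M₂ + 1), (h : ℝ) * ν h) * w)
    (hzx : z ≤ q' * ((∑ h ∈ Finset.range (M₁ + 1), (h : ℝ) * μ h) + q * ∑ h ∈ Finset.range (M₂ + 1), (h : ℝ) * ν h)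
      / ((∑ h ∈ Finset.range (M₁ + 1), (h : ℝ) * μ h) + ∑ h ∈ Finset.range (M₂ + 1), (h : ℝ) * ν h) * x)
    (j : ℕ) (hj : j < M₁ + M₂) :
    DECAt z j (M₁ + M₂) (gate (lconv M₁ M₂ μ (gate ν q)) q') := by
  set S : ℝ := ∑ h ∈ Finset.range (M₁ + 1), (h : ℝ) * μ h with hSdef
  set R : ℝ := ∑ h ∈ Finset.range (M₂ + 1), (h : ℝ) * ν h with hRdef
  have hR0 : 0 ≤ R := Finset.sum_nonneg fun h _ => mul_nonneg (Nat.cast_nonneg _) (hν0 h)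
  have hSR0 : 0 < S + R := by linarith
  have hSqR0 : 0 < S + q * R := by nlinarith
  -- the three parameters
  set a₁ : ℝ := q' * (S + q * R) / (S + R) with ha₁def
  set a₀ : ℝ := q' * (S + q * R) / S with ha₀def
  set t : ℝ := q * (S + R) / (S + q * R) with htdef
  have ha₁0 : 0 < a₁ := div_pos (mul_pos hq'0 hSqR0) hSR0
  have ha₁1 : a₁ ≤ 1 := by
    rw [ha₁def, div_le_one hSR0]; linarith
  have ha₀0 : 0 < a₀ := div_pos (mul_pos hq'0 hSqR0) hS0
  have ha₀1 : a₀ ≤ 1 := by rw [ha₀def, div_le_one hS0]; exact hB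
  have ht0 : 0 ≤ t := div_nonneg (mul_nonneg hq0.le hSR0.le) hSqR0.le
  have ht1 : t ≤ 1 := by
    rw [htdef, div_le_one hSqR0]; nlinarith
  have ha₁a₀ : a₁ ≤ a₀ := by
    rw [ha₁def, ha₀def]
    exact div_le_div_of_nonneg_left (mul_pos hq'0 hSqR0).le hS0 (by linarith)
  -- the common target
  set TE : ℝ := q' * (S + q * R) with hTEdef
  -- component 1: gate_{a₁}(μ ∗ ν), from SDEC of the opened product
  have hL1 : ∑ h ∈ Finset.range (M₁ + M₂ + 1), lconv M₁ M₂ μ ν h = 1 := sum_lconv M₁ M₂ μ ν hμ1 hν1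
  have hLmean : ∑ h ∈ Finset.range (M₁ + M₂ + 1), (h : ℝ) * lconv M₁ M₂ μ ν h = S + R :=
    sum_mul_lconv M₁ M₂ μ ν hμ1 hν1
  have h₁ : DECAtT z TE j (M₁ + M₂) (gate (lconv M₁ M₂ μ ν) a₁) := by
    have d := hL a₁ ha₁0 ha₁1 j hj
    have d' : DECAt z j (M₁ + M₂) (gate (lconv M₁ M₂ μ ν) a₁) :=
      decAt_mono_floor hzw (by nlinarith) d
    rw [decAt_iff_decAtT, sum_mul_gate, hLmean] at d'
    have e : a₁ * (S + R) = TE := by rw [ha₁def, hTEdef]; field_simp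
    rwa [e] at d'
  -- component 2: gate_{a₀} μ, from SDEC of the environment (layers below M₁) / Theorem A (layers ≥ M₁)
  have h₂ : DECAtT z TE j (M₁ + M₂) (gate μ a₀) := by
    have d : DECAt (a₀ * x) j M₁ (gate μ a₀) := by
      by_cases hjM : j < M₁
      · exact hSμ a₀ ha₀0 ha₀1 j hjM
      · exact decAt_gate_of_top_le M₁ μ x a₀ hx0.le (by nlinarith) ha₀0.le ha₀1 hμ0 hμM hμ1 hta j (not_lt.1 hjM)
    have d' : DECAt z j M₁ (gate μ a₀) :=
      decAt_mono_floor (hzx.trans (mul_le_mul_of_nonneg_right ha₁a₀ hx0.le)) (by nlinarith) d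
    rw [decAt_iff_decAtT, sum_mul_gate] at d'
    have e : a₀ * S = TE := by rw [ha₀def, hTEdef]; field_simp
    rw [e] at d'
    exact decAtT_mono_top d' (Nat.le_add_right M₁ M₂)
  -- the mixture at the common target
  have mix := decAtT_mixture t ht0 ht1 h₁ h₂
  have e : gate (lconv M₁ M₂ μ (gate ν q)) q' = fun h => t * gate (lconv M₁ M₂ μ ν) a₁ h + (1 - t) * gate μ a₀ h := by
    funext h
    rw [ha₁def, ha₀def, htdef]
    exact gateCoupling_mixture_B M₁ M₂ μ ν q q' S R hμM hS0.ne' hSR0.ne' hSqR0.ne' h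
  -- the mean of the doubly gated law is the common target
  obtain ⟨gν0, gνM, gν1⟩ := gate_laws M₂ ν q hq0.le hq1 hν0 hνM hν1
  have hEmean : ∑ h ∈ Finset.range (M₁ + M₂ + 1), (h : ℝ) * gate (lconv M₁ M₂ μ (gate ν q)) q' h = TE := by
    rw [sum_mul_gate, sum_mul_lconv M₁ M₂ μ (gate ν q) hμ1 gν1, sum_mul_gate]
  rw [decAt_iff_decAtT, hEmean, e]
  exact mix

/-- **CASE B IN TREE-INDUCTION FORM (increment no heavier than the environment).**  As above with the opened product `SDEC` at the
increment's floor `y ≤ x` (`0 < y`): for EVERY outer gate `0 < q′ ≤ S/(S + qR)` the law `gate_{q′}(μ ∗ gate_q ν)` is DEC(j) at every layer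
`j < M₁ + M₂` at the floor `q′·(q·y)` — the gated floor of the forest `μ ⊔ gate_q(ν)` when the increment carries its least marginal.
(`a⋆·y ≥ q′qy` because `S + qR ≥ q(S+R)`.) [this work] -/
theorem decAt_gateCoupling_B_light (x y q q' : ℝ) (M₁ M₂ : ℕ) (μ ν : ℕ → ℝ)
    (hx1 : x < 1) (hy0 : 0 < y) (hyx : y ≤ x) (hq0 : 0 < q) (hq1 : q ≤ 1) (hq'0 : 0 < q')
    (hμ0 : ∀ h, 0 ≤ μ h) (hμM : ∀ h, M₁ < h → μ h = 0) (hμ1 : ∑ h ∈ Finset.range (M₁ + 1), μ h = 1)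
    (hν0 : ∀ h, 0 ≤ ν h) (hνM : ∀ h, M₂ < h → ν h = 0) (hν1 : ∑ h ∈ Finset.range (M₂ + 1), ν h = 1)
    (hS0 : 0 < ∑ h ∈ Finset.range (M₁ + 1), (h : ℝ) * μ h)
    (hta : x * (M₁ : ℝ) ≤ ∑ h ∈ Finset.range (M₁ + 1), (h : ℝ) * μ h)
    (hB : q' * ((∑ h ∈ Finset.range (M₁ + 1), (h : ℝ) * μ h) + q * ∑ h ∈ Finset.range (M₂ + 1), (h : ℝ) * ν h)
      ≤ ∑ h ∈ Finset.range (M₁ + 1), (h : ℝ) * μ h)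
    (hSμ : SDEC x M₁ μ) (hL : SDEC y (M₁ + M₂) (lconv M₁ M₂ μ ν))
    (j : ℕ) (hj : j < M₁ + M₂) :
    DECAt (q' * (q * y)) j (M₁ + M₂) (gate (lconv M₁ M₂ μ (gate ν q)) q') := by
  set S : ℝ := ∑ h ∈ Finset.range (M₁ + 1), (h : ℝ) * μ h with hSdef
  set R : ℝ := ∑ h ∈ Finset.range (M₂ + 1), (h : ℝ) * ν h with hRdef
  have hR0 : 0 ≤ R := Finset.sum_nonneg fun h _ => mul_nonneg (Nat.cast_nonneg _) (hν0 h)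
  have hSR0 : 0 < S + R := by linarith
  have hx0 : 0 < x := lt_of_lt_of_le hy0 hyx
  -- `q′ q ≤ a⋆`
  have key : q' * q ≤ q' * (S + q * R) / (S + R) := by
    rw [le_div_iff₀ hSR0]
    have : q * (S + R) ≤ S + q * R := by nlinarith
    nlinarith
  have hzw : q' * (q * y) ≤ q' * (S + q * R) / (S + R) * y := by
    have := mul_le_mul_of_nonneg_right key hy0.le
    linarith
  have hzx : q' * (q * y) ≤ q' * (S + q * R) / (S + R) * x := by
    have h1 : q' * (S + q * R) / (S + R) * y ≤ q' * (S + q * R) / (S + R) * x :=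
      mul_le_mul_of_nonneg_left hyx (le_trans (by nlinarith) key)
    linarith
  exact decAt_gateCoupling_B x y (q' * (q * y)) q q' M₁ M₂ μ ν hx0 hx1 hy0.le (lt_of_le_of_lt hyx hx1) hq0 hq1 hq'0
    hμ0 hμM hμ1 hν0 hνM hν1 hS0 hta hB hSμ hL hzw hzx j hj

/-! ### CASE A: the complementary endpoint (conditional on the floor of the ungated-increment component) -/

/-- **CASE A** (`q′(S+qR) ≥ S`, `q′ < 1`... stated through its algebraic data): if the opened product `μ ∗ ν` is `SDEC` at a floor `w`,
and the ungated-increment law `μ ∗ gate_{b₀} ν` (`b₀ = q′q − (1−q′)S/R`) is DEC(j) at floor `z′` at its own mean (`ConvClosedT` gives this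
at `z′ = min(x, b₀y)`), then for every `z ≤ a⋆·w`, `z ≤ z′` the law `gate_{q′}(μ ∗ gate_q ν)` is DEC(j) at floor `z`.  The floor test
`z ≤ min(x, b₀ y)` is what FAILS in the tied regime (memo §3); recorded as the exact residual of the mixture route. [this work] -/
theorem decAt_gateCoupling_A (w z z' q q' : ℝ) (M₁ M₂ : ℕ) (μ ν : ℕ → ℝ)
    (hw0 : 0 ≤ w) (hw1 : w < 1) (hz'1 : z' < 1) (hq0 : 0 < q) (hq1 : q ≤ 1) (hq'0 : 0 < q') (hq'1 : q' < 1)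
    (hμ0 : ∀ h, 0 ≤ μ h) (hμM : ∀ h, M₁ < h → μ h = 0) (hμ1 : ∑ h ∈ Finset.range (M₁ + 1), μ h = 1)
    (hν0 : ∀ h, 0 ≤ ν h) (hνM : ∀ h, M₂ < h → ν h = 0) (hν1 : ∑ h ∈ Finset.range (M₂ + 1), ν h = 1)
    (hR0 : 0 < ∑ h ∈ Finset.range (M₂ + 1), (h : ℝ) * ν h)
    (hA : ∑ h ∈ Finset.range (M₁ + 1), (h : ℝ) * μ h
      ≤ q' * ((∑ h ∈ Finset.range (M₁ + 1), (h : ℝ) * μ h) + q * ∑ h ∈ Finset.range (M₂ + 1), (h : ℝ) * ν h))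
    (hL : SDEC w (M₁ + M₂) (lconv M₁ M₂ μ ν))
    (hzw : z ≤ q' * ((∑ h ∈ Finset.range (M₁ + 1), (h : ℝ) * μ h) + q * ∑ h ∈ Finset.range (M₂ + 1), (h : ℝ) * ν h)
      / ((∑ h ∈ Finset.range (M₁ + 1), (h : ℝ) * μ h) + ∑ h ∈ Finset.range (M₂ + 1), (h : ℝ) * ν h) * w)
    (hzz' : z ≤ z') (j : ℕ) (hj : j < M₁ + M₂)
    (hC : DECAt z' j (M₁ + M₂) (lconv M₁ M₂ μ (gate ν
      (q' * q - (1 - q') * (∑ h ∈ Finset.range (M₁ + 1), (h : ℝ) * μ h) / ∑ h ∈ Finset.range (M₂ + 1), (h : ℝ) * ν h)))) :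
    DECAt z j (M₁ + M₂) (gate (lconv M₁ M₂ μ (gate ν q)) q') := by
  set S : ℝ := ∑ h ∈ Finset.range (M₁ + 1), (h : ℝ) * μ h with hSdef
  set R : ℝ := ∑ h ∈ Finset.range (M₂ + 1), (h : ℝ) * ν h with hRdef
  have hS0 : 0 ≤ S := Finset.sum_nonneg fun h _ => mul_nonneg (Nat.cast_nonneg _) (hμ0 h)
  have hSR0 : 0 < S + R := by linarith
  have hSqR0 : 0 < S + q * R := by nlinarith
  set a₁ : ℝ := q' * (S + q * R) / (S + R) with ha₁def
  set b₀ : ℝ := q' * q - (1 - q') * S / R with hb₀def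
  have ha₁0 : 0 < a₁ := div_pos (mul_pos hq'0 hSqR0) hSR0
  have hqR : q * R ≤ R := by nlinarith
  have ha₁q' : a₁ ≤ q' := by
    rw [ha₁def, div_le_iff₀ hSR0]
    have : q' * (S + q * R) ≤ q' * (S + R) := mul_le_mul_of_nonneg_left (by linarith) hq'0.le
    linarith
  have ha₁1 : a₁ < 1 := lt_of_le_of_lt ha₁q' hq'1
  set v : ℝ := (1 - q') / (1 - a₁) with hvdef
  have hv0 : 0 ≤ v := div_nonneg (by linarith) (by linarith)
  have hv1 : v ≤ 1 := by rw [hvdef, div_le_one (by linarith)]; linarith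
  set TE : ℝ := q' * (S + q * R) with hTEdef
  have hLmean : ∑ h ∈ Finset.range (M₁ + M₂ + 1), (h : ℝ) * lconv M₁ M₂ μ ν h = S + R :=
    sum_mul_lconv M₁ M₂ μ ν hμ1 hν1
  -- component 1
  have h₁ : DECAtT z TE j (M₁ + M₂) (gate (lconv M₁ M₂ μ ν) a₁) := by
    have d := hL a₁ ha₁0 ha₁1.le j hj
    have d' : DECAt z j (M₁ + M₂) (gate (lconv M₁ M₂ μ ν) a₁) := decAt_mono_floor hzw (by nlinarith) d
    rw [decAt_iff_decAtT, sum_mul_gate, hLmean] at d'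
    have e : a₁ * (S + R) = TE := by rw [ha₁def, hTEdef]; field_simp
    rwa [e] at d'
  -- component 2: the ungated-increment law, mean `S + b₀ R = TE`
  have h₂ : DECAtT z TE j (M₁ + M₂) (lconv M₁ M₂ μ (gate ν b₀)) := by
    have d' : DECAt z j (M₁ + M₂) (lconv M₁ M₂ μ (gate ν b₀)) := decAt_mono_floor hzz' hz'1 hC
    obtain ⟨-, -, g1⟩ := gate_laws M₂ ν b₀ (by
      -- `0 ≤ b₀` from Case A: `q′qR ≥ (1−q′)S`
      rw [hb₀def, sub_nonneg, div_le_iff₀ hR0]; nlinarith) (by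
      rw [hb₀def]; have : 0 ≤ (1 - q') * S / R := div_nonneg (mul_nonneg (by linarith) hS0) hR0.le; nlinarith) hν0 hνM hν1
    rw [decAt_iff_decAtT, sum_mul_lconv M₁ M₂ μ (gate ν b₀) hμ1 g1, sum_mul_gate] at d'
    have e : S + b₀ * R = TE := by rw [hb₀def, hTEdef]; field_simp; ring
    rwa [e] at d'
  have mix := decAtT_mixture v hv0 hv1 h₁ h₂
  have e : gate (lconv M₁ M₂ μ (gate ν q)) q'
      = fun h => v * gate (lconv M₁ M₂ μ ν) a₁ h + (1 - v) * lconv M₁ M₂ μ (gate ν b₀) h := by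
    funext h
    rw [hvdef, ha₁def, hb₀def]
    have hne : S + R - q' * (S + q * R) ≠ 0 := by
      have : q' * (S + q * R) < S + R := by
        calc q' * (S + q * R) ≤ q' * (S + R) := mul_le_mul_of_nonneg_left (by linarith) hq'0.le
          _ < 1 * (S + R) := mul_lt_mul_of_pos_right hq'1 hSR0
          _ = S + R := one_mul _
      linarith
    exact gateCoupling_mixture_A M₁ M₂ μ ν q q' S R hμM hR0.ne' hSR0.ne' hne h
  obtain ⟨gν0, gνM, gν1⟩ := gate_laws M₂ ν q hq0.le hq1 hν0 hνM hν1
  have hEmean : ∑ h ∈ Finset.range (M₁ + M₂ + 1), (h : ℝ) * gate (lconv M₁ M₂ μ (gate ν q)) q' h = TE := by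
    rw [sum_mul_gate, sum_mul_lconv M₁ M₂ μ (gate ν q) hμ1 gν1, sum_mul_gate]
  rw [decAt_iff_decAtT, hEmean, e]
  exact mix

end LawDec

end Quant

end Summit.CriticalPhenomena.PercolationContinuityZ3.Theorems
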